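import Literature.Geometry.Riemannian.SphericalCylinderEntropy
import Literature.Geometry.Riemannian.ColdingMinicozziEntropyInvariance
import Literature.MeasureTheory.Hausdorff.SphereAreaGeneral
import Mathlib
import HarnessLib

/-!
# The conformal map `Φ(x, s) = eˢ x` of the spherical cylinder `N = S⁴ × ℝ ⊂ ℝ⁶` onto `ℝ⁵ ∖ {0}`:
# Lipschitz control, the layer-cake pushforward bound for `μH⁴`, and the pulled-back Euclidean distance

Topic `Literature/Geometry/Riemannian`; companion of `SphericalCylinderEntropy.lean` (the typed cylinder
entropy `λ_cyl` of subsets of `N`) and of `ColdingMinicozziEntropy.lean` (the Gaussian area `F_{y,t}` of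
subsets of `ℝ⁵`).  The conformal diffeomorphism `Φ : N → ℝ⁵ ∖ {0}`, `Φ(x, s) = eˢ x`, sends slices to round
spheres; this file collects the elementary measure-theoretic facts needed to transplant kernel estimates
from `N` to `ℝ⁵` (used by `SphericalCylinderSmallScaleDomination.lean`, the small-scale half of the
"conformal kernel domination" comparing `F_{y,t}(Φ A)` with `λ_cyl(A)`).  Everything is about the FIXED pair
of spaces `(N, ℝ⁵)`, `N = {z ∈ ℝ⁶ | ∑_{i<5} zᵢ² = 1}`, with `Φ` written as the literal lambda
`fun z => WithLp.toLp 2 (fun i : Fin 5 => exp (z 5) * z (Fin.castSucc i))`; all statements are proved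
(no definitions, no named facts).

* `dist_conf_le`: **`Φ|_N` is `e^M`-Lipschitz on `N ∩ {z₅ ≤ M}`** — the exact bound
  `‖Φ z - Φ w‖² = (e^{z₅} - e^{w₅})² + 2 e^{z₅+w₅}(1 - ⟨z', w'⟩) ≤ e^{2M} ‖z - w‖²`;
  hence `hausdorffMeasure_image_conf_le`: `μH⁴(Φ S) ≤ e^{4M} μH⁴(S)` for `S ⊆ N ∩ {z₅ ≤ M}` (Mathlib
  `LipschitzOnWith.hausdorffMeasure_image_le`; Federer 2.10.11).
* `lintegral_image_le_of_layers` (**layer cake**): for a measurable `A ⊆ ℝ⁶`, a measurable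
  `F : ℝ⁶ → ℝ⁵` distorting `μH⁴` on pieces of `A` below height `M` by at most `e^{4M}`, every `h > 0` and
  measurable `g ≥ 0`: `∫_{F(A)} g dμH⁴ ≤ e^{4h} ∫_A e^{4z₅} g(F z) dμH⁴(z)` (slice `A` into the height
  layers `{jh ≤ z₅ < (j+1)h}`, `j ∈ ℤ`, and dominate `μH⁴⌊F(layer)` by `e^{4(j+1)h} F_#(μH⁴⌊layer)`);
  `lintegral_image_le_of_layers_euclidean`: the same for Mathlib's normalised `μHE⁴ = c · μH⁴`.
* `norm_conf`, `norm_conf_sub_sq`: `‖Φ z‖ = e^{z₅}` and the pulled-back squared distance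
  `‖Φ z - y‖² = ‖y‖² ((e^{z₅}/‖y‖ - 1)² + 2 (e^{z₅}/‖y‖)(1 - ⟨z', y/‖y‖⟩))` for `z ∈ N`, `y ≠ 0`;
  `center_mem`: the matching cylinder centre `(y/‖y‖, log ‖y‖) ∈ N`.
* `euclideanHausdorffMeasure_sphere_four`: `μHE⁴(S⁴ ⊂ ℝ⁵) = 8π²/3` (tree
  `euclideanHausdorffMeasure_unitSphere_general` and `Γ(5/2) = 3√π/4`).

## References
* H. Federer, *Geometric Measure Theory* (1969), 2.10.11 (Lipschitz maps and `μH`).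
* T. H. Colding, W. P. Minicozzi II, Ann. of Math. 175 (2012) 755–833 (the functional `F_{y,t}`).
-/

noncomputable section

open Set Function MeasureTheory MeasureTheory.Measure
open scoped ENNReal NNReal BigOperators
open Literature.Geometry.Manifold.CylinderSlice
open Literature.Geometry.Riemannian.SphericalCylinderEntropy

namespace Literature.Geometry.Riemannian.SphericalCylinderConformal




/-! ### Lipschitz control of `Φ(z) = e^{z₅} z'` on height sublevel sets of `N` -/

/-- `(eᵃ - eᵇ)² ≤ e^{2M} (a - b)²` for `a, b ≤ M` (mean value bound for `exp`). [folklore] -/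
theorem exp_sub_exp_sq_le {a b M : ℝ} (ha : a ≤ M) (hb : b ≤ M) :
    (Real.exp a - Real.exp b) ^ 2 ≤ Real.exp M ^ 2 * (a - b) ^ 2 := by
  wlog hab : b ≤ a generalizing a b
  · have h := this hb ha (le_of_not_ge hab)
    calc (Real.exp a - Real.exp b) ^ 2 = (Real.exp b - Real.exp a) ^ 2 := by ring
      _ ≤ Real.exp M ^ 2 * (b - a) ^ 2 := h
      _ = Real.exp M ^ 2 * (a - b) ^ 2 := by ring
  · have h1 : Real.exp a * (b - a + 1) ≤ Real.exp b := by
      calc Real.exp a * (b - a + 1) ≤ Real.exp a * Real.exp (b - a) :=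
            mul_le_mul_of_nonneg_left (Real.add_one_le_exp (b - a)) (Real.exp_pos a).le
        _ = Real.exp b := by rw [← Real.exp_add]; ring_nf
    have h2 : 0 ≤ Real.exp a - Real.exp b := sub_nonneg.2 (Real.exp_le_exp.2 hab)
    have hMa : Real.exp a ≤ Real.exp M := Real.exp_le_exp.2 ha
    have h3 : Real.exp a - Real.exp b ≤ Real.exp M * (a - b) := by
      have h4 : Real.exp a - Real.exp b ≤ Real.exp a * (a - b) := by nlinarith
      exact h4.trans (mul_le_mul_of_nonneg_right hMa (by linarith))
    calc (Real.exp a - Real.exp b) ^ 2 ≤ (Real.exp M * (a - b)) ^ 2 := pow_le_pow_left₀ h2 h3 2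
      _ = Real.exp M ^ 2 * (a - b) ^ 2 := by ring

/-- Coordinate form of `‖Φ z - Φ w‖² ≤ e^{2M} ‖z - w‖²` on `N ∩ {z₅ ≤ M}`:
`∑ᵢ (e^{z₅} zᵢ - e^{w₅} wᵢ)² ≤ e^{2M} (∑ᵢ (zᵢ - wᵢ)² + (z₅ - w₅)²)`. [folklore] -/
theorem sum_sq_conf_sub_le {z w : EuclideanSpace ℝ (Fin 6)} (hz : ∑ i : Fin 5, z (Fin.castSucc i) ^ 2 = 1)
    (hw : ∑ i : Fin 5, w (Fin.castSucc i) ^ 2 = 1) {M : ℝ} (hzM : z 5 ≤ M) (hwM : w 5 ≤ M) :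
    ∑ i : Fin 5, (Real.exp (z 5) * z (Fin.castSucc i) - Real.exp (w 5) * w (Fin.castSucc i)) ^ 2 ≤
      Real.exp M ^ 2 * (∑ i : Fin 5, (z (Fin.castSucc i) - w (Fin.castSucc i)) ^ 2 + (z 5 - w 5) ^ 2) := by
  set a := z 5 with ha
  set b := w 5 with hb
  set P := ∑ i : Fin 5, z (Fin.castSucc i) * w (Fin.castSucc i) with hP_def
  have hP : P ≤ 1 := (abs_le.1 (abs_sum_mul_le_one hz hw)).2
  have hL : ∑ i : Fin 5, (Real.exp a * z (Fin.castSucc i) - Real.exp b * w (Fin.castSucc i)) ^ 2 =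
      Real.exp a ^ 2 + Real.exp b ^ 2 - 2 * (Real.exp a * Real.exp b) * P := by
    have h : ∀ i : Fin 5, (Real.exp a * z (Fin.castSucc i) - Real.exp b * w (Fin.castSucc i)) ^ 2 =
        Real.exp a ^ 2 * z (Fin.castSucc i) ^ 2 + Real.exp b ^ 2 * w (Fin.castSucc i) ^ 2 -
          2 * (Real.exp a * Real.exp b) * (z (Fin.castSucc i) * w (Fin.castSucc i)) := fun i => by ring
    simp only [h, Finset.sum_add_distrib, Finset.sum_sub_distrib, ← Finset.mul_sum, hz, hw, mul_one, hP_def]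
  have hR : ∑ i : Fin 5, (z (Fin.castSucc i) - w (Fin.castSucc i)) ^ 2 = 2 - 2 * P := by
    have h : ∀ i : Fin 5, (z (Fin.castSucc i) - w (Fin.castSucc i)) ^ 2 =
        z (Fin.castSucc i) ^ 2 + w (Fin.castSucc i) ^ 2 - 2 * (z (Fin.castSucc i) * w (Fin.castSucc i)) :=
      fun i => by ring
    simp only [h, Finset.sum_add_distrib, Finset.sum_sub_distrib, ← Finset.mul_sum, hz, hw, hP_def]
    ring
  rw [hL, hR]
  have h1 := exp_sub_exp_sq_le hzM hwM
  have hea : Real.exp a ≤ Real.exp M := Real.exp_le_exp.2 hzM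
  have heb : Real.exp b ≤ Real.exp M := Real.exp_le_exp.2 hwM
  have h2 : Real.exp a * Real.exp b ≤ Real.exp M ^ 2 := by
    rw [sq]; exact mul_le_mul hea heb (Real.exp_pos b).le (Real.exp_pos M).le
  have h3 : Real.exp a * Real.exp b * (1 - P) ≤ Real.exp M ^ 2 * (1 - P) :=
    mul_le_mul_of_nonneg_right h2 (by linarith)
  nlinarith [h1, h3]

/-- **`Φ|_N` is `e^M`-Lipschitz below height `M`**: for `z, w ∈ N` with `z₅, w₅ ≤ M`,
`‖Φ z - Φ w‖ ≤ e^M ‖z - w‖`, `Φ(z) = e^{z₅} z'`. [folklore] -/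
theorem dist_conf_le {z w : EuclideanSpace ℝ (Fin 6)} (hz : ∑ i : Fin 5, z (Fin.castSucc i) ^ 2 = 1)
    (hw : ∑ i : Fin 5, w (Fin.castSucc i) ^ 2 = 1) {M : ℝ} (hzM : z 5 ≤ M) (hwM : w 5 ≤ M) :
    dist (WithLp.toLp 2 (fun i : Fin 5 => Real.exp (z 5) * z (Fin.castSucc i)) : EuclideanSpace ℝ (Fin 5))
        (WithLp.toLp 2 (fun i : Fin 5 => Real.exp (w 5) * w (Fin.castSucc i)) : EuclideanSpace ℝ (Fin 5)) ≤
      Real.exp M * dist z w := by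
  rw [EuclideanSpace.dist_eq, EuclideanSpace.dist_eq z w, ← Real.sqrt_sq (Real.exp_pos M).le,
    ← Real.sqrt_mul (sq_nonneg _)]
  refine Real.sqrt_le_sqrt ?_
  simp only [Real.dist_eq, sq_abs]
  rw [Fin.sum_univ_castSucc (f := fun j : Fin 6 => (z j - w j) ^ 2)]
  exact sum_sq_conf_sub_le hz hw hzM hwM

/-- **Hausdorff-measure distortion of `Φ` on pieces of `N` below height `M`**:
`μH⁴(Φ S) ≤ e^{4M} μH⁴(S)` for `S ⊆ N ∩ {z₅ ≤ M}` (Lipschitz maps and `μH`, Federer 2.10.11;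
Mathlib `LipschitzOnWith.hausdorffMeasure_image_le`). [folklore] -/
theorem hausdorffMeasure_image_conf_le (M : ℝ) (S : Set (EuclideanSpace ℝ (Fin 6)))
    (hS : ∀ z ∈ S, ∑ i : Fin 5, z (Fin.castSucc i) ^ 2 = 1) (hM : ∀ z ∈ S, z 5 ≤ M) :
    μH[4] ((fun z : EuclideanSpace ℝ (Fin 6) =>
        (WithLp.toLp 2 (fun i : Fin 5 => Real.exp (z 5) * z (Fin.castSucc i)) :
          EuclideanSpace ℝ (Fin 5))) '' S) ≤
      ENNReal.ofReal (Real.exp (4 * M)) * μH[4] S := by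
  have hLip : LipschitzOnWith (Real.toNNReal (Real.exp M))
      (fun z : EuclideanSpace ℝ (Fin 6) =>
        (WithLp.toLp 2 (fun i : Fin 5 => Real.exp (z 5) * z (Fin.castSucc i)) :
          EuclideanSpace ℝ (Fin 5))) S :=
    LipschitzOnWith.of_dist_le' fun z hz w hw => dist_conf_le (hS z hz) (hS w hw) (hM z hz) (hM w hw)
  refine (hLip.hausdorffMeasure_image_le (by norm_num)).trans (le_of_eq ?_)
  congr 1
  rw [show ((Real.toNNReal (Real.exp M) : ℝ≥0) : ℝ≥0∞) = ENNReal.ofReal (Real.exp M) from rfl,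
    show ((4 : ℝ)) = ((4 : ℕ) : ℝ) by norm_num, ENNReal.rpow_natCast,
    ← ENNReal.ofReal_pow (Real.exp_pos M).le, ← Real.exp_nat_mul]

/-! ### The layer-cake pushforward bound -/

/-- The height layers `A ∩ {jh ≤ z₅ < (j+1)h}` cover `A`. [folklore] -/
theorem layers_cover (A : Set (EuclideanSpace ℝ (Fin 6))) {h : ℝ} (hh : 0 < h) :
    A = ⋃ n : ℤ, A ∩ (fun z : EuclideanSpace ℝ (Fin 6) => z 5) ⁻¹' Ico (n • h) ((n + 1) • h) := by
  rw [← Set.inter_iUnion, ← Set.preimage_iUnion, iUnion_Ico_zsmul hh, Set.preimage_univ,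
    Set.inter_univ]

/-- The height layers are pairwise disjoint. [folklore] -/
theorem layers_disjoint (A : Set (EuclideanSpace ℝ (Fin 6))) (h : ℝ) :
    Pairwise (Function.onFun Disjoint fun n : ℤ =>
      A ∩ (fun z : EuclideanSpace ℝ (Fin 6) => z 5) ⁻¹' Ico (n • h) ((n + 1) • h)) := by
  intro m n hmn
  have hd := pairwise_disjoint_Ico_zsmul h hmn
  exact Disjoint.mono inter_subset_right inter_subset_right (hd.preimage _)

/-- The height is a measurable function on `ℝ⁶`. [folklore] -/
theorem measurable_height : Measurable fun z : EuclideanSpace ℝ (Fin 6) => z 5 := by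
  fun_prop

/-- The height layers of a measurable set are measurable. [folklore] -/
theorem layers_measurable {A : Set (EuclideanSpace ℝ (Fin 6))} (hA : MeasurableSet A) (h : ℝ) (n : ℤ) :
    MeasurableSet (A ∩ (fun z : EuclideanSpace ℝ (Fin 6) => z 5) ⁻¹' Ico (n • h) ((n + 1) • h)) :=
  hA.inter (measurableSet_Ico.preimage measurable_height)

/-- One piece: if `μH⁴(F S') ≤ c μH⁴(S')` for all `S' ⊆ S`, then
`∫_{F S} g dμH⁴ ≤ c ∫_S g ∘ F dμH⁴` (the measure `μH⁴⌊F(S)` is dominated by `c · F_#(μH⁴⌊S)`).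
[folklore] -/
theorem lintegral_image_piece_le {F : EuclideanSpace ℝ (Fin 6) → EuclideanSpace ℝ (Fin 5)}
    (hF : Measurable F) {S : Set (EuclideanSpace ℝ (Fin 6))} {c : ℝ≥0∞}
    (hc : ∀ S' ⊆ S, μH[4] (F '' S') ≤ c * μH[4] S') {g : EuclideanSpace ℝ (Fin 5) → ℝ≥0∞}
    (hg : Measurable g) :
    ∫⁻ w in F '' S, g w ∂μH[4] ≤ c * ∫⁻ z in S, g (F z) ∂μH[4] := by
  have hle : (μH[4] : Measure (EuclideanSpace ℝ (Fin 5))).restrict (F '' S) ≤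
      c • (((μH[4] : Measure (EuclideanSpace ℝ (Fin 6))).restrict S).map F) := by
    rw [Measure.le_iff]
    intro s hs
    rw [Measure.restrict_apply hs, Measure.smul_apply, Measure.map_apply hF hs,
      Measure.restrict_apply (hF hs), smul_eq_mul, Set.inter_comm, ← Set.image_inter_preimage,
      Set.inter_comm (F ⁻¹' s)]
    exact hc _ inter_subset_left
  calc ∫⁻ w in F '' S, g w ∂μH[4]
      ≤ ∫⁻ w, g w ∂(c • (((μH[4] : Measure (EuclideanSpace ℝ (Fin 6))).restrict S).map F)) :=
        lintegral_mono' hle le_rfl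
    _ = c * ∫⁻ z in S, g (F z) ∂μH[4] := by rw [lintegral_smul_measure, lintegral_map hg hF, smul_eq_mul]

/-- **Layer-cake pushforward bound.** Let `F : ℝ⁶ → ℝ⁵` be measurable and distort `μH⁴` on pieces of
`A` below height `M` by at most `e^{4M}`. Then for every `h > 0` and measurable `g ≥ 0`,
`∫_{F(A)} g dμH⁴ ≤ e^{4h} ∫_A e^{4 z₅} g(F z) dμH⁴(z)` (slice `A` into height layers of width `h`).
[folklore] -/
theorem lintegral_image_le_of_layers {A : Set (EuclideanSpace ℝ (Fin 6))} (hA : MeasurableSet A)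
    {F : EuclideanSpace ℝ (Fin 6) → EuclideanSpace ℝ (Fin 5)} (hF : Measurable F)
    (hL : ∀ (M : ℝ) (S : Set (EuclideanSpace ℝ (Fin 6))), S ⊆ A → (∀ z ∈ S, z 5 ≤ M) →
      μH[4] (F '' S) ≤ ENNReal.ofReal (Real.exp (4 * M)) * μH[4] S)
    {g : EuclideanSpace ℝ (Fin 5) → ℝ≥0∞} (hg : Measurable g) {h : ℝ} (hh : 0 < h) :
    ∫⁻ w in F '' A, g w ∂μH[4] ≤
      ENNReal.ofReal (Real.exp (4 * h)) *
        ∫⁻ z in A, ENNReal.ofReal (Real.exp (4 * z 5)) * g (F z) ∂μH[4] := by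
  set L : ℤ → Set (EuclideanSpace ℝ (Fin 6)) := fun n =>
    A ∩ (fun z : EuclideanSpace ℝ (Fin 6) => z 5) ⁻¹' Ico (n • h) ((n + 1) • h) with hL_def
  have hcover : A = ⋃ n, L n := layers_cover A hh
  have hdisj : Pairwise (Function.onFun Disjoint L) := layers_disjoint A h
  have hmeas : ∀ n, MeasurableSet (L n) := layers_measurable hA h
  have hlayer : ∀ n : ℤ, ∫⁻ w in F '' L n, g w ∂μH[4] ≤
      ENNReal.ofReal (Real.exp (4 * ((n + 1) • h))) * ∫⁻ z in L n, g (F z) ∂μH[4] := fun n =>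
    lintegral_image_piece_le hF (fun S' hS' => hL _ S' (hS'.trans inter_subset_left)
      (fun z hz => (hS' hz).2.2.le)) hg
  have hbound : ∀ n : ℤ, ∀ z ∈ L n, ENNReal.ofReal (Real.exp (4 * ((n + 1) • h))) ≤
      ENNReal.ofReal (Real.exp (4 * h)) * ENNReal.ofReal (Real.exp (4 * z 5)) := by
    intro n z hz
    rw [← ENNReal.ofReal_mul (Real.exp_pos _).le, ← Real.exp_add]
    refine ENNReal.ofReal_le_ofReal (Real.exp_le_exp.2 ?_)
    have h1 : n • h ≤ z 5 := hz.2.1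
    rw [zsmul_eq_mul] at h1
    rw [zsmul_eq_mul]
    push_cast
    nlinarith
  calc ∫⁻ w in F '' A, g w ∂μH[4] = ∫⁻ w in ⋃ n, F '' L n, g w ∂μH[4] := by
        rw [← Set.image_iUnion, ← hcover]
    _ ≤ ∑' n, ∫⁻ w in F '' L n, g w ∂μH[4] := lintegral_iUnion_le _ _
    _ ≤ ∑' n, ∫⁻ z in L n, ENNReal.ofReal (Real.exp (4 * h)) *
          (ENNReal.ofReal (Real.exp (4 * z 5)) * g (F z)) ∂μH[4] := by
        refine ENNReal.tsum_le_tsum fun n => (hlayer n).trans ?_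
        rw [← lintegral_const_mul' _ _ ENNReal.ofReal_ne_top]
        refine setLIntegral_mono' (hmeas n) fun z hz => ?_
        calc ENNReal.ofReal (Real.exp (4 * ((n + 1) • h))) * g (F z)
            ≤ (ENNReal.ofReal (Real.exp (4 * h)) * ENNReal.ofReal (Real.exp (4 * z 5))) * g (F z) :=
              mul_le_mul' (hbound n z hz) le_rfl
          _ = _ := by ring
    _ = ENNReal.ofReal (Real.exp (4 * h)) *
          ∫⁻ z in A, ENNReal.ofReal (Real.exp (4 * z 5)) * g (F z) ∂μH[4] := by
        rw [← lintegral_const_mul' _ _ ENNReal.ofReal_ne_top]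
        conv_rhs => rw [hcover]
        rw [lintegral_iUnion hmeas hdisj]

/-- The layer-cake pushforward bound for Mathlib's normalised Hausdorff measure `μHE⁴`
(`= c · μH⁴` with one constant `c` on `ℝ⁵` and `ℝ⁶`). [folklore] -/
theorem lintegral_image_le_of_layers_euclidean {A : Set (EuclideanSpace ℝ (Fin 6))}
    (hA : MeasurableSet A) {F : EuclideanSpace ℝ (Fin 6) → EuclideanSpace ℝ (Fin 5)}
    (hF : Measurable F)
    (hL : ∀ (M : ℝ) (S : Set (EuclideanSpace ℝ (Fin 6))), S ⊆ A → (∀ z ∈ S, z 5 ≤ M) →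
      μH[4] (F '' S) ≤ ENNReal.ofReal (Real.exp (4 * M)) * μH[4] S)
    {g : EuclideanSpace ℝ (Fin 5) → ℝ≥0∞} (hg : Measurable g) {h : ℝ} (hh : 0 < h) :
    ∫⁻ w in F '' A, g w ∂μHE[4] ≤
      ENNReal.ofReal (Real.exp (4 * h)) *
        ∫⁻ z in A, ENNReal.ofReal (Real.exp (4 * z 5)) * g (F z) ∂μHE[4] := by
  rw [setLIntegral_euclideanHausdorffMeasure_eq_mul, setLIntegral_euclideanHausdorffMeasure_eq_mul,
    mul_left_comm]
  gcongr
  exact_mod_cast lintegral_image_le_of_layers hA hF hL hg hh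


/-! ### The conformal map: continuity, norm, pulled-back distance, matching centre -/

/-- The conformal map is continuous (hence Borel measurable). [folklore] -/
theorem continuous_conf : Continuous fun z : EuclideanSpace ℝ (Fin 6) =>
    (WithLp.toLp 2 (fun i : Fin 5 => Real.exp (z 5) * z (Fin.castSucc i)) : EuclideanSpace ℝ (Fin 5)) := by
  fun_prop


/-- `‖Φ z‖ = e^{z₅}` for `z ∈ N`. [folklore] -/
theorem norm_conf {z : EuclideanSpace ℝ (Fin 6)} (hz : ∑ i : Fin 5, z (Fin.castSucc i) ^ 2 = 1) :
    ‖(WithLp.toLp 2 (fun i : Fin 5 => Real.exp (z 5) * z (Fin.castSucc i)) :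
      EuclideanSpace ℝ (Fin 5))‖ = Real.exp (z 5) := by
  have h : ‖(WithLp.toLp 2 (fun i : Fin 5 => Real.exp (z 5) * z (Fin.castSucc i)) :
      EuclideanSpace ℝ (Fin 5))‖ ^ 2 = Real.exp (z 5) ^ 2 := by
    rw [EuclideanSpace.real_norm_sq_eq]
    simp only [mul_pow, ← Finset.mul_sum, hz, mul_one]
  exact (pow_left_inj₀ (norm_nonneg _) (Real.exp_pos _).le two_ne_zero).1 h

/-- **The pulled-back squared distance**: for `z ∈ N` and `y ≠ 0`,
`‖Φ z - y‖² = ‖y‖² ((eˢ/‖y‖ - 1)² + 2 (eˢ/‖y‖)(1 - ⟨z', ŷ⟩))`, `s = z₅`, `ŷ = y/‖y‖`. [folklore] -/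
theorem norm_conf_sub_sq {z : EuclideanSpace ℝ (Fin 6)} (hz : ∑ i : Fin 5, z (Fin.castSucc i) ^ 2 = 1)
    {y : EuclideanSpace ℝ (Fin 5)} (hy : y ≠ 0) :
    ‖(WithLp.toLp 2 (fun i : Fin 5 => Real.exp (z 5) * z (Fin.castSucc i)) :
        EuclideanSpace ℝ (Fin 5)) - y‖ ^ 2 = ‖y‖ ^ 2 * ((Real.exp (z 5) / ‖y‖ - 1) ^ 2 +
        2 * (Real.exp (z 5) / ‖y‖) * (1 - ∑ i : Fin 5, z (Fin.castSucc i) * (‖y‖⁻¹ • y) i)) := by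
  have hr : 0 < ‖y‖ := norm_pos_iff.2 hy
  have hy2 : ∑ i : Fin 5, y i ^ 2 = ‖y‖ ^ 2 := (EuclideanSpace.real_norm_sq_eq y).symm
  rw [EuclideanSpace.real_norm_sq_eq]
  simp only [PiLp.sub_apply, PiLp.smul_apply, smul_eq_mul]
  have h : ∀ i : Fin 5, (Real.exp (z 5) * z (Fin.castSucc i) - y i) ^ 2 =
      Real.exp (z 5) ^ 2 * z (Fin.castSucc i) ^ 2 + y i ^ 2 -
        2 * Real.exp (z 5) * (z (Fin.castSucc i) * y i) := fun i => by ring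
  have h2 : ∀ i : Fin 5, z (Fin.castSucc i) * (‖y‖⁻¹ * y i) = ‖y‖⁻¹ * (z (Fin.castSucc i) * y i) :=
    fun i => by ring
  simp only [h, h2, Finset.sum_add_distrib, Finset.sum_sub_distrib, ← Finset.mul_sum, hz, hy2, mul_one]
  field_simp
  ring

/-- **The matching cylinder centre** `p = (ŷ, log ‖y‖) ∈ N` for a Euclidean centre `y ≠ 0`: it lies on
`N`, its base point is `ŷ = y/‖y‖` and its height is `log ‖y‖`. [folklore] -/
theorem center_mem {y : EuclideanSpace ℝ (Fin 5)} (hy : y ≠ 0) :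
    (∑ i : Fin 5, (padL (‖y‖⁻¹ • y) + Real.log ‖y‖ • axis) (Fin.castSucc i) ^ 2 = 1) ∧
    (∀ i : Fin 5, (padL (‖y‖⁻¹ • y) + Real.log ‖y‖ • axis) (Fin.castSucc i) = (‖y‖⁻¹ • y) i) ∧
    (padL (‖y‖⁻¹ • y) + Real.log ‖y‖ • axis) 5 = Real.log ‖y‖ := by
  have hr : 0 < ‖y‖ := norm_pos_iff.2 hy
  have hcoord : ∀ i : Fin 5,
      (padL (‖y‖⁻¹ • y) + Real.log ‖y‖ • axis) (Fin.castSucc i) = (‖y‖⁻¹ • y) i := by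
    intro i
    simp [axis, castSucc_ne_five i]
  have hlast : (padL (‖y‖⁻¹ • y) + Real.log ‖y‖ • axis) 5 = Real.log ‖y‖ := by simp [axis]
  refine ⟨?_, hcoord, hlast⟩
  simp only [hcoord]
  have h1 : ‖(‖y‖⁻¹ • y)‖ = 1 := by rw [norm_smul, norm_inv, norm_norm, inv_mul_cancel₀ hr.ne']
  have h2 := EuclideanSpace.real_norm_sq_eq (‖y‖⁻¹ • y)
  rw [h1, one_pow] at h2
  exact h2.symm

/-! ### The area of `S⁴` for `μHE⁴` -/

/-- `Γ(5/2) = (3/4)√π`. [folklore] -/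
theorem Gamma_five_halves : Real.Gamma (5 / 2) = 3 / 4 * Real.sqrt Real.pi := by
  have h1 : Real.Gamma (3 / 2 + 1) = 3 / 2 * Real.Gamma (3 / 2) := Real.Gamma_add_one (by norm_num)
  have h2 : Real.Gamma (1 / 2 + 1) = 1 / 2 * Real.Gamma (1 / 2) := Real.Gamma_add_one (by norm_num)
  rw [show (5 : ℝ) / 2 = 3 / 2 + 1 by norm_num, h1, show (3 : ℝ) / 2 = 1 / 2 + 1 by norm_num, h2,
    Real.Gamma_one_half_eq]
  ring

/-- **`μHE⁴(S⁴) = 8π²/3 = vol(S⁴)`** for Mathlib's normalised Hausdorff measure on `ℝ⁵` (tree: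
`euclideanHausdorffMeasure_unitSphere_general`, `2π^{5/2}/Γ(5/2) = 8π²/3`). [folklore] -/
theorem euclideanHausdorffMeasure_sphere_four :
    (μHE[4] : Measure (EuclideanSpace ℝ (Fin 5))) (Metric.sphere (0 : EuclideanSpace ℝ (Fin 5)) 1) =
      ENNReal.ofReal (8 * Real.pi ^ 2 / 3) := by
  rw [Literature.MeasureTheory.Hausdorff.euclideanHausdorffMeasure_unitSphere_general
    (E := (EuclideanSpace ℝ (Fin 5))) (d := 4) finrank_euclideanSpace_fin (by norm_num)]
  congr 1
  have hπ : 0 < Real.pi := Real.pi_pos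
  have hs : Real.sqrt Real.pi ≠ 0 := (Real.sqrt_pos.2 hπ).ne'
  have h52 : (((4 : ℕ) : ℝ) + 1) / 2 = 5 / 2 := by norm_num
  have hpow : Real.pi ^ ((5 : ℝ) / 2) = Real.pi ^ 2 * Real.sqrt Real.pi := by
    rw [show (5 : ℝ) / 2 = (2 : ℕ) + 1 / 2 by norm_num, Real.rpow_add hπ, Real.rpow_natCast,
      Real.sqrt_eq_rpow]
  rw [h52, hpow, Gamma_five_halves]
  field_simp
  norm_num


end Literature.Geometry.Riemannian.SphericalCylinderConformal

end
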